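/-
COR-CM (cell pub-hodgecm2 = stage 2 of the Hodge ladder), seat b26 gen 9 (prover-pub-hodgecm2-b26-g9-0, 2026-08-21);
count-neutral for the binder table (no row): the two BARRIER named facts on exceptional Hodge classes of abelian
varieties, and the simple CM `6/8/9/33`-folds with `Bᵖ ≠ Dᵖ` of `Literature/AlgebraicGeometry/Pohlmann1968`, made
HYPOTHESIS-FREE.  Theorems only: no definition, no named fact, no instance, no new constant of type
`CMAbelianVarietyRealised` (RULING E-DEDUP of the cell: the existence record is CONSUMED as the term
`cmAbelianVarietyRealised_of_riemann (deligneMilne1982_Thm_6_20_full_of_lieAddGroup langeBirkenhake_lemma_1_1_2_weak)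
deligneMilne1982_Thm_6_20_essImage_holds`).
-/
import Summits.HodgeConjecture.CorCM.Geometry.RiemannEssentialImage
import Literature.AlgebraicGeometry.ComplexMultiplication.CMAbelianVarietyRealisedOfRiemann
import Literature.AlgebraicGeometry.HodgeTheory.AbelianVarietyHodgeFullnessOfLieGroupTorus
import Literature.Geometry.Kaehler.CompactComplexLieGroupTorusOfExp
import Literature.AlgebraicGeometry.Pohlmann1968.ExceptionalHodgeClassesCMWeilType
import Literature.AlgebraicGeometry.Pohlmann1968.MumfordSimpleFourfold
import Literature.AlgebraicGeometry.Pohlmann1968.DegenerateCMTypeCyclotomic21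
import Literature.AlgebraicGeometry.Pohlmann1968.DegenerateCMTypesRibetLenstraSerre
import HarnessLib

/-!
# Exceptional Hodge classes on CM abelian varieties exist — the barrier facts, hypothesis-free

The two catalogued barrier records of `Literature/Barriers/HodgeConjecture/ExceptionalHodgeClasses`,

* `Barriers.HodgeConjecture.Weil1977_exceptionalHodgeClasses` — Weil 1977 / van Geemen 1994 Thm. 4.11: for every
  `n ≥ 2` an abelian `2n`-fold with a rational `(n,n)`-class outside the ring of divisor classes («`Bⁿ ≠ Dⁿ`»), and
* `Barriers.HodgeConjecture.Mumford1968_simpleFourfold_exceptionalHodgeClasses` — Pohlmann 1968 §3 (Mumford) /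
  van Geemen 1994 Thm. 4.5: «There exist simple four dimensional abelian varieties with `B² ≠ D²`»,

were proved in the tree MODULO the existence of CM abelian varieties of every prescribed CM type, read on `H¹`
(`PicardCM.CMAbelianVarietyRealised`, Shimura 1998 §6.2 Thm. 3 — the cell's displayed binder `h₃`):
`Pohlmann1968.WeilTypeWitness.weil1977_exceptionalHodgeClasses_of_cmAbelianVarietyRealised` (the `2n`-folds
`A₉ × E^{2n-3}`, `A₉` of type `(ℚ(ζ₉); {σ₁, σ₂, σ₄})`, `E` with CM by `ℤ[ζ₃]`, Weil class over `ℚ(ζ₃)`) and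
`Pohlmann1968.MumfordFourfold.mumford1968_simpleFourfold_exceptionalHodgeClasses_of_cmAbelianVarietyRealised`
(Mumford's own data: `K = ℚ(α, i)`, `3α⁴ - 6α² + α + 1 = 0`, CM types of Weil type `(2,2)` for `ℚ(i)`, primitive ⇒
simple by Shimura §8.2 Prop. 26, exceptional class by Pohlmann's Theorem 1).

The existence record is now a THEOREM, by the two clauses of Riemann's theorem (Deligne–Milne 1982 Thm. 6.20):
`ComplexMultiplication.cmAbelianVarietyRealised_of_riemann (hR) (hE)` (cell seat b18) with FULLNESS
`hR := HodgeTheory.deligneMilne1982_Thm_6_20_full_of_lieAddGroup Kaehler.langeBirkenhake_lemma_1_1_2_weak`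
(= `HodgeTheory.deligneMilne1982_Thm_6_20_full_holds`, `Literature/AlgebraicGeometry/HodgeTheory/AbelianVarietyHodgeFullnessHolds`)
and ESSENTIAL IMAGE `hE := deligneMilne1982_Thm_6_20_essImage_holds` (`CorCM/Geometry/RiemannEssentialImage`).  Hence:

* `weil1977_exceptionalHodgeClasses_holds : Barriers.HodgeConjecture.Weil1977_exceptionalHodgeClasses`;
* `mumford1968_simpleFourfold_exceptionalHodgeClasses_holds :
    Barriers.HodgeConjecture.Mumford1968_simpleFourfold_exceptionalHodgeClasses`;
* `exists_simple_sixfold_exceptionalHodgeClasses` — a SIMPLE abelian sixfold with complex multiplication by the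
  abelian field `ℚ(ζ₂₁)` and `B³ ≠ D³` (the primitive DEGENERATE type `Φ₂₁`, balanced `(3,3)` over `ℚ(√-3)`;
  `Pohlmann1968/DegenerateCMTypeCyclotomic21`);
* `exists_simple_eightfold_exceptionalHodgeClasses`, `exists_simple_ninefold_exceptionalHodgeClasses`,
  `exists_simple_thirtyThreefold_exceptionalHodgeClasses` — Lenstra's `ℚ(ζ₃₂)` (`B² ≠ D²`), Serre's `ℚ(ζ₁₉)`
  (`B³ ≠ D³`) and Ribet's `ℚ(ζ₆₇)` (`B¹¹ ≠ D¹¹`) degenerate types (`Pohlmann1968/DegenerateCMTypesRibetLenstraSerre`,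
  Gordon 1999 §9.4.2).

This file lives Summits-side only because the essential-image half of Riemann's theorem is proved Summits-side
(`CorCM/Geometry/RiemannEssentialImage`); every other input is a Literature theorem.  The same `h₃` term is the
cell's hypothesis-free existence constant (seat b17, `CorCM/Model/CMAbelianVarietyRealisedHolds`); it is written
out here rather than re-declared.

## References

* [vanGeemen1994HodgeAV] B. van Geemen, *An introduction to the Hodge conjecture for abelian varieties*, LNM 1594
  (1994), Thm. 4.5, 4.7, Thm. 4.11.
* [Pohlmann1968] H. Pohlmann, *Algebraic cycles on abelian varieties of complex multiplication type*, Ann. of Math.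
  (2) 88 (1968) 161–180, Thm. 1 and §3 (MR 37 #4080).
* [Weil1977HodgeRing] A. Weil, *Abelian varieties and the Hodge ring* [1977c], Œuvres III, 421–429.
* [Gordon1999HodgeAVSurvey] B. B. Gordon, *A survey of the Hodge conjecture for abelian varieties* (1999), 8.2, §9.2,
  9.2.2, §9.4.2–9.4.3.
* [Shimura1998] G. Shimura, *Abelian Varieties with Complex Multiplication and Modular Functions* (1998), §6.2
  Thm. 3, §8.2 Prop. 26.
* [DeligneMilne1982Tannakian] P. Deligne, J. S. Milne, *Tannakian Categories*, LNM 900 (1982), §6 Thm. 6.20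
  (Riemann), p. 212.
* [LangeBirkenhake1992] H. Lange, Ch. Birkenhake, *Complex Abelian Varieties* (1992), Ch. 1 §1 Lemma 1.1.2.
-/

noncomputable section

namespace Summit.HodgeConjecture.CorCM

open Literature.AlgebraicGeometry.Motives (AbelianVariety)
open Literature.AlgebraicGeometry.HodgeTheory
open Literature.AlgebraicGeometry.ComplexMultiplication (cmAbelianVarietyRealised_of_riemann)
open Literature.AlgebraicGeometry.Pohlmann1968
open Literature.Geometry.Kaehler (langeBirkenhake_lemma_1_1_2_weak)
open Literature.Barriers.HodgeConjecture (divisorClassesSpan Weil1977_exceptionalHodgeClasses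
  Mumford1968_simpleFourfold_exceptionalHodgeClasses)

/-- **Weil 1977 / van Geemen 1994 Thm. 4.11, hypothesis-free: exceptional Hodge classes exist** — for every `n ≥ 2`
there is a complex abelian variety `A` of dimension `2n` with a rational class of Hodge type `(n,n)` in
`H²ⁿ(A(ℂ); ℂ)` outside the span of products of divisor classes («`Bⁿ ≠ Dⁿ`»).  The BARRIER record
`Barriers.HodgeConjecture.Weil1977_exceptionalHodgeClasses` discharged: lit-pohlmann's CM witnesses
`A₉ × E^{2n-3}` (`weil1977_exceptionalHodgeClasses_of_cmAbelianVarietyRealised`) at the existence record of CM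
abelian varieties, itself a theorem by the two clauses of Riemann's theorem (`cmAbelianVarietyRealised_of_riemann`,
fullness `deligneMilne1982_Thm_6_20_full_of_lieAddGroup langeBirkenhake_lemma_1_1_2_weak`, essential image
`deligneMilne1982_Thm_6_20_essImage_holds`). [cite: vanGeemen1994HodgeAV, Thm. 4.11 and 4.7]
[cite: Pohlmann1968, Thm. 1 and §3] [cite: Shimura1998, §6.2 Theorem 3]
[cite: DeligneMilne1982Tannakian, §6 Thm. 6.20 (Riemann), p. 212] -/
theorem weil1977_exceptionalHodgeClasses_holds : Weil1977_exceptionalHodgeClasses :=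
  WeilTypeWitness.weil1977_exceptionalHodgeClasses_of_cmAbelianVarietyRealised
    (cmAbelianVarietyRealised_of_riemann
      (deligneMilne1982_Thm_6_20_full_of_lieAddGroup langeBirkenhake_lemma_1_1_2_weak)
      deligneMilne1982_Thm_6_20_essImage_holds)

/-- **Mumford's simple CM fourfolds with `B² ≠ D²` exist (Pohlmann 1968 §3; van Geemen 1994 Thm. 4.5),
hypothesis-free**: there is a SIMPLE complex abelian fourfold with a rational `(2,2)`-class in `H⁴(A(ℂ); ℂ)`
outside the span of products of two divisor classes.  The BARRIER record
`Barriers.HodgeConjecture.Mumford1968_simpleFourfold_exceptionalHodgeClasses` discharged: lit-pohlmann's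
formalisation of Mumford's own example (`K = ℚ(α, i)`, `3α⁴ - 6α² + α + 1 = 0`, Weil-`(2,2)` CM types for `ℚ(i)`;
`mumford1968_simpleFourfold_exceptionalHodgeClasses_of_cmAbelianVarietyRealised`) at the existence record of CM
abelian varieties, itself a theorem by Riemann's theorem (`cmAbelianVarietyRealised_of_riemann`, fullness
`deligneMilne1982_Thm_6_20_full_of_lieAddGroup langeBirkenhake_lemma_1_1_2_weak`, essential image
`deligneMilne1982_Thm_6_20_essImage_holds`). [cite: vanGeemen1994HodgeAV, Thm. 4.5 and 4.7] [cite: Pohlmann1968, §3]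
[cite: Gordon1999HodgeAVSurvey, 8.2 and 9.2.2] [cite: Shimura1998, §6.2 Theorem 3 and §8.2 Prop. 26]
[cite: DeligneMilne1982Tannakian, §6 Thm. 6.20 (Riemann), p. 212] -/
theorem mumford1968_simpleFourfold_exceptionalHodgeClasses_holds :
    Mumford1968_simpleFourfold_exceptionalHodgeClasses :=
  MumfordFourfold.mumford1968_simpleFourfold_exceptionalHodgeClasses_of_cmAbelianVarietyRealised
    (cmAbelianVarietyRealised_of_riemann
      (deligneMilne1982_Thm_6_20_full_of_lieAddGroup langeBirkenhake_lemma_1_1_2_weak)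
      deligneMilne1982_Thm_6_20_essImage_holds)

/-- **A simple abelian SIXFOLD with complex multiplication by the abelian field `ℚ(ζ₂₁)` and `B³ ≠ D³`,
hypothesis-free**: a realisation of the primitive, degenerate CM type `(ℚ(ζ₂₁); Φ₂₁)` exists (Riemann's theorem)
and is simple of dimension `6` with a rational `(3,3)`-class outside the ring generated by divisor classes — the
dimension-`6` cyclotomic analogue of Mumford's simple fourfolds (`ℚ(√-3) ⊂ ℚ(ζ₂₁)` acting with multiplicities
`(3,3)`; Gordon 5.13 (ii), van Geemen 4.7). [cite: vanGeemen1994HodgeAV, Thm. 4.5 and 4.7] [cite: Pohlmann1968, §3]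
[cite: Shimura1998, §6.2 Theorem 3 and §8.2 Prop. 26] [cite: DeligneMilne1982Tannakian, §6 Thm. 6.20 (Riemann), p. 212] -/
theorem exists_simple_sixfold_exceptionalHodgeClasses :
    ∃ A : AbelianVariety ℂ, A.IsSimple ∧ A.dim = 6 ∧ Literature.AlgebraicGeometry.Motives.IsSmoothProjective 6 A.X ∧
      ∃ c : complexBetti A.X (2 * 3), IsRationalClass c ∧ IsOfHodgeType 6 A.X (2 * 3) 3 3 c ∧
        c ∉ divisorClassesSpan A.X 6 3 :=
  Cyclotomic.exists_simple_sixfold_exceptionalHodgeClasses_of_cmAbelianVarietyRealised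
    (cmAbelianVarietyRealised_of_riemann
      (deligneMilne1982_Thm_6_20_full_of_lieAddGroup langeBirkenhake_lemma_1_1_2_weak)
      deligneMilne1982_Thm_6_20_essImage_holds)

/-- **A simple abelian `8`-fold with complex multiplication by `ℚ(ζ₃₂)` and `B² ≠ D²` (Lenstra's degenerate type
`Φ′`), hypothesis-free.** [cite: Gordon1999HodgeAVSurvey, §9.4.2] [cite: Shimura1998, §6.2 Theorem 3 and §8.2 Prop. 26]
[cite: DeligneMilne1982Tannakian, §6 Thm. 6.20 (Riemann), p. 212] -/
theorem exists_simple_eightfold_exceptionalHodgeClasses :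
    ∃ A : AbelianVariety ℂ, A.IsSimple ∧ A.dim = 8 ∧ Literature.AlgebraicGeometry.Motives.IsSmoothProjective 8 A.X ∧
      ∃ c : complexBetti A.X (2 * 2), IsRationalClass c ∧ IsOfHodgeType 8 A.X (2 * 2) 2 2 c ∧
        c ∉ divisorClassesSpan A.X 8 2 :=
  Cyclotomic.exists_simple_eightfold_exceptionalHodgeClasses_of_cmAbelianVarietyRealised
    (cmAbelianVarietyRealised_of_riemann
      (deligneMilne1982_Thm_6_20_full_of_lieAddGroup langeBirkenhake_lemma_1_1_2_weak)
      deligneMilne1982_Thm_6_20_essImage_holds)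

/-- **A simple abelian `9`-fold with complex multiplication by `ℚ(ζ₁₉)` and `B³ ≠ D³` (Serre's degenerate type),
hypothesis-free.** [cite: Gordon1999HodgeAVSurvey, §9.4.2] [cite: Shimura1998, §6.2 Theorem 3 and §8.2 Prop. 26]
[cite: DeligneMilne1982Tannakian, §6 Thm. 6.20 (Riemann), p. 212] -/
theorem exists_simple_ninefold_exceptionalHodgeClasses :
    ∃ A : AbelianVariety ℂ, A.IsSimple ∧ A.dim = 9 ∧ Literature.AlgebraicGeometry.Motives.IsSmoothProjective 9 A.X ∧
      ∃ c : complexBetti A.X (2 * 3), IsRationalClass c ∧ IsOfHodgeType 9 A.X (2 * 3) 3 3 c ∧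
        c ∉ divisorClassesSpan A.X 9 3 :=
  Cyclotomic.exists_simple_ninefold_exceptionalHodgeClasses_of_cmAbelianVarietyRealised
    (cmAbelianVarietyRealised_of_riemann
      (deligneMilne1982_Thm_6_20_full_of_lieAddGroup langeBirkenhake_lemma_1_1_2_weak)
      deligneMilne1982_Thm_6_20_essImage_holds)

/-- **A simple abelian `33`-fold with complex multiplication by `ℚ(ζ₆₇)` and `B¹¹ ≠ D¹¹` (Ribet's degenerate type),
hypothesis-free.** [cite: Gordon1999HodgeAVSurvey, §9.4.2] [cite: Shimura1998, §6.2 Theorem 3 and §8.2 Prop. 26]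
[cite: DeligneMilne1982Tannakian, §6 Thm. 6.20 (Riemann), p. 212] -/
theorem exists_simple_thirtyThreefold_exceptionalHodgeClasses :
    ∃ A : AbelianVariety ℂ, A.IsSimple ∧ A.dim = 33 ∧ Literature.AlgebraicGeometry.Motives.IsSmoothProjective 33 A.X ∧
      ∃ c : complexBetti A.X (2 * 11), IsRationalClass c ∧ IsOfHodgeType 33 A.X (2 * 11) 11 11 c ∧
        c ∉ divisorClassesSpan A.X 33 11 :=
  Cyclotomic.exists_simple_thirtyThreefold_exceptionalHodgeClasses_of_cmAbelianVarietyRealised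
    (cmAbelianVarietyRealised_of_riemann
      (deligneMilne1982_Thm_6_20_full_of_lieAddGroup langeBirkenhake_lemma_1_1_2_weak)
      deligneMilne1982_Thm_6_20_essImage_holds)

end Summit.HodgeConjecture.CorCM

end
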